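import Summits.Ventures.PackingBounds.Energy.DiploSimplexAntipodalUniversal
import Mathlib.Analysis.Analytic.Binomial

/-!
# Rigidity of the antipodal optimum: strict potentials, and every Riesz energy (all `n ≥ 3`)

Framing: lottery ticket; floor = certified bounds/negative ranges. Venture `PackingBounds` (cell `pub-packcert`,
seat `pub-packcert-energy`, gen 26) — rider file of `DiploSimplexAntipodal` / `DiploSimplexAntipodalUniversal`.

`DiploSimplexAntipodal.nodeset_of_energy_le` turns a STRICT even supporting line into rigidity. Here the strictness
is supplied: (i) for `(1+t)^4` the supporting line at `t₀` has the exact gain `2 (t² - t₀²)²` (`even_pow_four`), so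
an antipodal `(2n+2)`-configuration with `Σ (1+⟪x,y⟫)^4` at most the diplo value is a node-set configuration
(`ckFour_nodeset_of_energy_le`); (ii) for `a = Σ_k c_k (1+t)^k`, `c_k ≥ 0`, the energy deficit is the convergent sum
`Σ_k c_k (deficit of (1+t)^k)` of non-negative terms (`hasSum_deficit`), so `c_4 > 0` and energy `≤` the diplo value
force the `k = 4` deficit to vanish: node set, hence isometric to the diplo-simplex (`nodeset_of_hasSum_energy_le`,
`isometric_of_hasSum_energy_le`); (iii) the Riesz potential `(2 - 2t)^{-p}`, `p > 0`, is such a series with ALL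
coefficients positive — the binomial series `(2-2t)^{-p} = 4^{-p} Σ_k ((p)_k / k!) ((1+t)/2)^k` on `[-1,1)`
(`riesz_hasSum`, from Mathlib's `Real.one_div_one_sub_rpow_hasFPowerSeriesOnBall_zero`) — so:
**Theorem (`riesz_nodeset_of_energy_le`, `riesz_minimisers_isometric`).** For every `n ≥ 3` and `p > 0`, every
antipodal configuration of `2n+2` unit vectors of `ℝⁿ` whose Riesz energy `Σ_{x ≠ y} (2 - 2⟪x,y⟫)^{-p}` does not exceed
`(2n+2)(4^{-p} + n(2+2/n)^{-p} + n(2-2/n)^{-p})` has all inner products in `{-1, ±1/n}` and is isometric to the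
diplo-simplex: the diplo-simplex is the UNIQUE optimal antipodal configuration of its size for every Riesz energy
(Ballinger et al. 2009 §3.4 state the code version; Cohn–Kumar 2007 §8 / Cohn–Woo 2012 §5.2 the projective LP bound).

## References
* H. Cohn, A. Kumar, J. Amer. Math. Soc. 20 (2007) 99–148, §8. [`CohnKumar2006`]
* H. Cohn, J. Woo, J. Amer. Math. Soc. 25 (2012) 929–958, §5.2. [`CohnWoo2012`]
* B. Ballinger et al., Experiment. Math. 18 (2009) 257–283, §3.4. [`BallingerEtAl2009`]
-/

noncomputable section

open Finset

namespace Summit.Ventures.PackingBounds.Energy.DiploSimplexAntipodal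

variable {n : ℕ}

/-! ## `(1+t)^4`: exact gain `2 (t² - t₀²)²` -/

/-- `(1+t)^4 + (1-t)^4 = (1+t₀)^4 + (1-t₀)^4 + (12 + 4t₀²)(t² - t₀²) + 2(t² - t₀²)²`. [folklore] -/
theorem even_pow_four (t t₀ : ℝ) : (1 + t) ^ 4 + (1 - t) ^ 4 =
    (1 + t₀) ^ 4 + (1 - t₀) ^ 4 + (12 + 4 * t₀ ^ 2) * (t ^ 2 - t₀ ^ 2) + 2 * (t ^ 2 - t₀ ^ 2) ^ 2 := by
  ring

open scoped Classical in
/-- **Rigidity for `(1+t)^4`** (every `n ≥ 3`): an antipodal configuration of `2n+2` unit vectors of `ℝⁿ` with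
`Σ_{x ≠ y} (1+⟪x,y⟫)^4 ≤ (2n+2)(0 + n(1-1/n)^4 + n(1+1/n)^4)` has all pairwise inner products in `{-1, -1/n, 1/n}`.
[cite: CohnKumar2006, §8] -/
theorem ckFour_nodeset_of_energy_le (hn : 3 ≤ n) (C : Finset (EuclideanSpace ℝ (Fin n)))
    (h1 : ∀ x ∈ C, ‖x‖ = 1) (hN : C.card = 2 * n + 2) (hanti : ∀ x ∈ C, -x ∈ C)
    (hle : ∑ x ∈ C, ∑ y ∈ C.erase x, (1 + inner ℝ x y) ^ 4 ≤
      (2 * n + 2 : ℝ) * ((1 + (-1 : ℝ)) ^ 4 + n * (1 + -1 / (n : ℝ)) ^ 4 + n * (1 + 1 / (n : ℝ)) ^ 4)) :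
    ∀ x ∈ C, ∀ y ∈ C, x ≠ y →
      inner ℝ x y = -1 ∨ inner ℝ x y = -1 / (n : ℝ) ∨ inner ℝ x y = 1 / (n : ℝ) := by
  have hsq : (1 / (n : ℝ)) ^ 2 = 1 / (n : ℝ) ^ 2 := by rw [div_pow, one_pow]
  have e1 : (1 + -1 / (n : ℝ)) = 1 - 1 / (n : ℝ) := by ring
  refine nodeset_of_energy_le hn (fun t => (1 + t) ^ 4) (12 + 4 * (1 / (n : ℝ)) ^ 2) C h1 hN hanti
    (by positivity) ?_ ?_ hle
  · intro t _ _
    have e := even_pow_four t (1 / (n : ℝ))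
    have e2 : (1 + -t) = 1 - t := by ring
    rw [e1, e2, ← hsq]
    nlinarith [sq_nonneg (t ^ 2 - (1 / (n : ℝ)) ^ 2)]
  · intro t _ _ hne
    have e := even_pow_four t (1 / (n : ℝ))
    have e2 : (1 + -t) = 1 - t := by ring
    rw [← hsq] at hne
    have hpos : 0 < (t ^ 2 - (1 / (n : ℝ)) ^ 2) ^ 2 := by
      have : t ^ 2 - (1 / (n : ℝ)) ^ 2 ≠ 0 := sub_ne_zero.2 hne
      positivity
    rw [e1, e2, ← hsq]
    linarith

/-! ## Power-series potentials: the deficit is a convergent sum of non-negative terms -/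

open scoped Classical in
/-- **Deficit decomposition.** For `a(s) = Σ_k c_k (1+s)^k` on `[-1,1)` and any configuration `C` of unit vectors of
`ℝⁿ` (`n ≥ 3`): `E_a(C) - (2n+2)(a(-1) + n a(-1/n) + n a(1/n)) = Σ_k c_k [E_k(C) - (2n+2)(0^k + n(1-1/n)^k + n(1+1/n)^k)]`
as a convergent sum (`E_k` the `(1+t)^k`-energy). [folklore] -/
theorem hasSum_deficit (hn : 3 ≤ n) (a : ℝ → ℝ) (c : ℕ → ℝ)
    (ha : ∀ s : ℝ, -1 ≤ s → s < 1 → HasSum (fun k => c k * (1 + s) ^ k) (a s))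
    (C : Finset (EuclideanSpace ℝ (Fin n))) (h1 : ∀ x ∈ C, ‖x‖ = 1) :
    HasSum (fun k => c k * (∑ x ∈ C, ∑ y ∈ C.erase x, (1 + inner ℝ x y) ^ k -
        (2 * n + 2 : ℝ) * ((1 + (-1 : ℝ)) ^ k + n * (1 + -1 / (n : ℝ)) ^ k + n * (1 + 1 / (n : ℝ)) ^ k)))
      (∑ x ∈ C, ∑ y ∈ C.erase x, a (inner ℝ x y) -
        (2 * n + 2 : ℝ) * (a (-1) + n * a (-1 / (n : ℝ)) + n * a (1 / (n : ℝ)))) := by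
  have hn3 : (3 : ℝ) ≤ n := by exact_mod_cast hn
  have hnpos : (0 : ℝ) < n := by linarith
  have hE : HasSum (fun k => ∑ x ∈ C, ∑ y ∈ C.erase x, c k * (1 + inner ℝ x y) ^ k)
      (∑ x ∈ C, ∑ y ∈ C.erase x, a (inner ℝ x y)) := by
    refine hasSum_sum fun x hx => hasSum_sum fun y hy => ?_
    have hb := NewtonCert.inner_mem_Ico_of_norm_eq_one (h1 x hx) (h1 y (mem_of_mem_erase hy))
      (ne_of_mem_erase hy).symm
    exact ha _ hb.1 hb.2
  have hm1 : HasSum (fun k => c k * (1 + (-1 : ℝ)) ^ k) (a (-1)) := ha (-1) le_rfl (by norm_num)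
  have hinv0 : 0 < 1 / (n : ℝ) := by positivity
  have hinv1 : 1 / (n : ℝ) < 1 := by rw [div_lt_one hnpos]; linarith
  have hm2 : HasSum (fun k => c k * (1 + -1 / (n : ℝ)) ^ k) (a (-1 / (n : ℝ))) :=
    ha _ (by rw [neg_div]; linarith) (by rw [neg_div]; linarith)
  have hm3 : HasSum (fun k => c k * (1 + 1 / (n : ℝ)) ^ k) (a (1 / (n : ℝ))) :=
    ha _ (by linarith) hinv1
  have hB := ((hm1.add (hm2.mul_left (n : ℝ))).add (hm3.mul_left (n : ℝ))).mul_left (2 * n + 2 : ℝ)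
  have h := hE.sub hB
  refine h.congr_fun fun k => ?_
  simp only [mul_sub, Finset.mul_sum]
  ring

open scoped Classical in
/-- **Rigidity for power-series potentials with `c_4 > 0`** (every `n ≥ 3`): if `a(s) = Σ_k c_k (1+s)^k` on `[-1,1)`
with `c_k ≥ 0` and `c_4 > 0`, an antipodal configuration of `2n+2` unit vectors of `ℝⁿ` whose `a`-energy does not
exceed the diplo-simplex value `(2n+2)(a(-1) + n a(-1/n) + n a(1/n))` has all pairwise inner products in
`{-1, -1/n, 1/n}`. [cite: CohnKumar2006, §8] -/
theorem nodeset_of_hasSum_energy_le (hn : 3 ≤ n) (a : ℝ → ℝ) (c : ℕ → ℝ) (hc : ∀ k, 0 ≤ c k)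
    (hc4 : 0 < c 4) (ha : ∀ s : ℝ, -1 ≤ s → s < 1 → HasSum (fun k => c k * (1 + s) ^ k) (a s))
    (C : Finset (EuclideanSpace ℝ (Fin n))) (h1 : ∀ x ∈ C, ‖x‖ = 1) (hN : C.card = 2 * n + 2)
    (hanti : ∀ x ∈ C, -x ∈ C)
    (hle : ∑ x ∈ C, ∑ y ∈ C.erase x, a (inner ℝ x y) ≤
      (2 * n + 2 : ℝ) * (a (-1) + n * a (-1 / (n : ℝ)) + n * a (1 / (n : ℝ)))) :
    ∀ x ∈ C, ∀ y ∈ C, x ≠ y →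
      inner ℝ x y = -1 ∨ inner ℝ x y = -1 / (n : ℝ) ∨ inner ℝ x y = 1 / (n : ℝ) := by
  have hdef := hasSum_deficit hn a c ha C h1
  have hterm : ∀ k, 0 ≤ c k * (∑ x ∈ C, ∑ y ∈ C.erase x, (1 + inner ℝ x y) ^ k -
      (2 * n + 2 : ℝ) * ((1 + (-1 : ℝ)) ^ k + n * (1 + -1 / (n : ℝ)) ^ k + n * (1 + 1 / (n : ℝ)) ^ k)) :=
    fun k => mul_nonneg (hc k) (sub_nonneg.2 (ckPow_energy_ge hn k C h1 hN hanti))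
  have h4 := le_hasSum hdef 4 fun j _ => hterm j
  refine ckFour_nodeset_of_energy_le hn C h1 hN hanti (le_of_not_gt fun hgt => ?_)
  have : 0 < c 4 * (∑ x ∈ C, ∑ y ∈ C.erase x, (1 + inner ℝ x y) ^ 4 -
      (2 * n + 2 : ℝ) * ((1 + (-1 : ℝ)) ^ 4 + n * (1 + -1 / (n : ℝ)) ^ 4 + n * (1 + 1 / (n : ℝ)) ^ 4)) :=
    mul_pos hc4 (sub_pos.2 hgt)
  linarith

open scoped Classical in
/-- **Isometry rider for power-series potentials with `c_4 > 0`**: such an antipodal configuration is isometric to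
every node-set configuration, in particular to the diplo-simplex, and any two such minimisers are isometric.
[cite: BallingerEtAl2009, §3.4] -/
theorem isometric_of_hasSum_energy_le (hn : 3 ≤ n) (a : ℝ → ℝ) (c : ℕ → ℝ) (hc : ∀ k, 0 ≤ c k)
    (hc4 : 0 < c 4) (ha : ∀ s : ℝ, -1 ≤ s → s < 1 → HasSum (fun k => c k * (1 + s) ^ k) (a s))
    (C : Finset (EuclideanSpace ℝ (Fin n))) (h1 : ∀ x ∈ C, ‖x‖ = 1) (hN : C.card = 2 * n + 2)
    (hanti : ∀ x ∈ C, -x ∈ C)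
    (hle : ∑ x ∈ C, ∑ y ∈ C.erase x, a (inner ℝ x y) ≤
      (2 * n + 2 : ℝ) * (a (-1) + n * a (-1 / (n : ℝ)) + n * a (1 / (n : ℝ))))
    (X : Finset (EuclideanSpace ℝ (Fin n))) (hX1 : ∀ x ∈ X, ‖x‖ = 1) (hXcard : X.card = 2 * n + 2)
    (hXZ : ∀ x ∈ X, ∀ y ∈ X, x ≠ y →
      inner ℝ x y = -1 ∨ inner ℝ x y = -1 / (n : ℝ) ∨ inner ℝ x y = 1 / (n : ℝ)) :
    ∃ Ψ : EuclideanSpace ℝ (Fin n) ≃ₗᵢ[ℝ] EuclideanSpace ℝ (Fin n), C = X.image Ψ :=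
  Config.DiploSimplexUnique.isometric_of_nodesets hn X C hX1 hXcard hXZ h1 hN
    (nodeset_of_hasSum_energy_le hn a c hc hc4 ha C h1 hN hanti hle)

/-! ## Riesz potentials: the binomial series, and rigidity for every `p > 0` -/

/-- `Ring.choose (p + k - 1) k = (p)_k / k!` over `ℝ`. [folklore] -/
theorem choose_add_sub_one_eq (p : ℝ) (k : ℕ) :
    Ring.choose (p + k - 1) k = (k.factorial : ℝ)⁻¹ * (ascPochhammer ℝ k).eval p := by
  rw [← Ring.multichoose_eq]
  have h := Ring.factorial_nsmul_multichoose_eq_ascPochhammer p k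
  rw [Polynomial.ascPochhammer_smeval_eq_eval, nsmul_eq_mul] at h
  have hk : (k.factorial : ℝ) ≠ 0 := by exact_mod_cast k.factorial_ne_zero
  field_simp
  linarith [h]

/-- **Binomial series of the Riesz potential on `[-1,1)`:**
`(2 - 2s)^{-p} = Σ_k [4^{-p} · ((p)_k / k!) · 2^{-k}] (1+s)^k` (from `(1-y)^{-p} = Σ_k ((p)_k/k!) y^k`, `y = (1+s)/2`).
[folklore] -/
theorem riesz_hasSum (p s : ℝ) (hs1 : -1 ≤ s) (hs2 : s < 1) :
    HasSum (fun k : ℕ => ((4 : ℝ) ^ (-p) * ((k.factorial : ℝ)⁻¹ * (ascPochhammer ℝ k).eval p) *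
        (1 / 2) ^ k) * (1 + s) ^ k) ((2 - 2 * s) ^ (-p)) := by
  set y : ℝ := (1 + s) / 2 with hy
  have hy0 : 0 ≤ y := by rw [hy]; linarith
  have hy1 : y < 1 := by rw [hy]; linarith
  have hmem : y ∈ Metric.eball (0 : ℝ) 1 := by
    rw [Metric.mem_eball, edist_zero_right, enorm_eq_nnnorm]
    have : ‖y‖₊ < 1 := by
      rw [← NNReal.coe_lt_coe, coe_nnnorm, NNReal.coe_one, Real.norm_eq_abs, abs_lt]
      exact ⟨by linarith, hy1⟩
    exact_mod_cast this
  have h := (Real.one_div_one_sub_rpow_hasFPowerSeriesOnBall_zero p).hasSum hmem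
  simp only [FormalMultilinearSeries.ofScalars_apply_eq, smul_eq_mul, zero_add] at h
  have h1y : 0 < 1 - y := by linarith
  have hval : (2 - 2 * s) ^ (-p) = (4 : ℝ) ^ (-p) * (1 / (1 - y) ^ p) := by
    have e : (2 : ℝ) - 2 * s = 4 * (1 - y) := by rw [hy]; ring
    rw [e, Real.mul_rpow (by norm_num) h1y.le, Real.rpow_neg h1y.le, one_div]
  have hfun : (fun k : ℕ => ((4 : ℝ) ^ (-p) * ((k.factorial : ℝ)⁻¹ * (ascPochhammer ℝ k).eval p) *
      (1 / 2) ^ k) * (1 + s) ^ k) = fun k : ℕ => (4 : ℝ) ^ (-p) * (Ring.choose (p + k - 1) k * y ^ k) := by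
    funext k
    rw [choose_add_sub_one_eq, hy, div_pow, div_pow, one_pow]
    ring
  rw [hval, hfun]
  exact h.mul_left ((4 : ℝ) ^ (-p))

/-- The binomial coefficients of the Riesz potential are positive for `p > 0`. [folklore] -/
theorem riesz_coeff_pos (p : ℝ) (hp : 0 < p) (k : ℕ) :
    0 < (4 : ℝ) ^ (-p) * ((k.factorial : ℝ)⁻¹ * (ascPochhammer ℝ k).eval p) * (1 / 2) ^ k := by
  have h4 : 0 < (4 : ℝ) ^ (-p) := Real.rpow_pos_of_pos (by norm_num) _
  have hf : 0 < (k.factorial : ℝ)⁻¹ := inv_pos.2 (by exact_mod_cast k.factorial_pos)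
  have ha := ascPochhammer_pos k p hp
  positivity

open scoped Classical in
/-- **Rigidity of the antipodal Riesz optimum (every `n ≥ 3`, every `p > 0`).** An antipodal configuration of `2n+2`
unit vectors of `ℝⁿ` whose Riesz energy `Σ_{x ≠ y} (2 - 2⟪x,y⟫)^{-p}` does not exceed the diplo-simplex value
`(2n+2)(4^{-p} + n (2+2/n)^{-p} + n (2-2/n)^{-p})` has all pairwise inner products in `{-1, -1/n, 1/n}`.
[cite: BallingerEtAl2009, §3.4] -/
theorem riesz_nodeset_of_energy_le (hn : 3 ≤ n) (p : ℝ) (hp : 0 < p) (C : Finset (EuclideanSpace ℝ (Fin n)))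
    (h1 : ∀ x ∈ C, ‖x‖ = 1) (hN : C.card = 2 * n + 2) (hanti : ∀ x ∈ C, -x ∈ C)
    (hle : ∑ x ∈ C, ∑ y ∈ C.erase x, (2 - 2 * inner ℝ x y) ^ (-p) ≤
      (2 * n + 2 : ℝ) * ((4 : ℝ) ^ (-p) + n * (2 + 2 / (n : ℝ)) ^ (-p) + n * (2 - 2 / (n : ℝ)) ^ (-p))) :
    ∀ x ∈ C, ∀ y ∈ C, x ≠ y →
      inner ℝ x y = -1 ∨ inner ℝ x y = -1 / (n : ℝ) ∨ inner ℝ x y = 1 / (n : ℝ) := by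
  have e1 : (2 : ℝ) - 2 * (-1) = 4 := by norm_num
  have e2 : (2 : ℝ) - 2 * (-1 / (n : ℝ)) = 2 + 2 / (n : ℝ) := by ring
  have e3 : (2 : ℝ) - 2 * (1 / (n : ℝ)) = 2 - 2 / (n : ℝ) := by ring
  have hle' : ∑ x ∈ C, ∑ y ∈ C.erase x, (2 - 2 * inner ℝ x y) ^ (-p) ≤
      (2 * n + 2 : ℝ) * ((2 - 2 * (-1) : ℝ) ^ (-p) + n * (2 - 2 * (-1 / (n : ℝ))) ^ (-p) +
        n * (2 - 2 * (1 / (n : ℝ))) ^ (-p)) := by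
    rw [e1, e2, e3]; exact hle
  exact nodeset_of_hasSum_energy_le hn (fun t => (2 - 2 * t) ^ (-p))
    (fun k => (4 : ℝ) ^ (-p) * ((k.factorial : ℝ)⁻¹ * (ascPochhammer ℝ k).eval p) * (1 / 2) ^ k)
    (fun k => (riesz_coeff_pos p hp k).le) (riesz_coeff_pos p hp 4)
    (fun s hs1 hs2 => riesz_hasSum p s hs1 hs2) C h1 hN hanti hle'

open scoped Classical in
/-- **The diplo-simplex is the UNIQUE optimal antipodal configuration for every Riesz energy** (every `n ≥ 3`,
`p > 0`): any two antipodal `(2n+2)`-configurations of `S^{n-1}` with Riesz energy at most the diplo-simplex value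
are isometric (and each is isometric to the diplo-simplex, a node-set configuration, `Config.DiploSimplex.exists_config`).
[cite: BallingerEtAl2009, §3.4] -/
theorem riesz_minimisers_isometric (hn : 3 ≤ n) (p : ℝ) (hp : 0 < p)
    (C C' : Finset (EuclideanSpace ℝ (Fin n)))
    (h1 : ∀ x ∈ C, ‖x‖ = 1) (hN : C.card = 2 * n + 2) (hanti : ∀ x ∈ C, -x ∈ C)
    (hle : ∑ x ∈ C, ∑ y ∈ C.erase x, (2 - 2 * inner ℝ x y) ^ (-p) ≤
      (2 * n + 2 : ℝ) * ((4 : ℝ) ^ (-p) + n * (2 + 2 / (n : ℝ)) ^ (-p) + n * (2 - 2 / (n : ℝ)) ^ (-p)))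
    (h1' : ∀ x ∈ C', ‖x‖ = 1) (hN' : C'.card = 2 * n + 2) (hanti' : ∀ x ∈ C', -x ∈ C')
    (hle' : ∑ x ∈ C', ∑ y ∈ C'.erase x, (2 - 2 * inner ℝ x y) ^ (-p) ≤
      (2 * n + 2 : ℝ) * ((4 : ℝ) ^ (-p) + n * (2 + 2 / (n : ℝ)) ^ (-p) + n * (2 - 2 / (n : ℝ)) ^ (-p))) :
    ∃ Ψ : EuclideanSpace ℝ (Fin n) ≃ₗᵢ[ℝ] EuclideanSpace ℝ (Fin n), C' = C.image Ψ :=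
  Config.DiploSimplexUnique.isometric_of_nodesets hn C C' h1 hN
    (riesz_nodeset_of_energy_le hn p hp C h1 hN hanti hle) h1' hN'
    (riesz_nodeset_of_energy_le hn p hp C' h1' hN' hanti' hle')

open scoped Classical in
/-- Every antipodal Riesz minimiser is isometric to every node-set configuration (e.g. the diplo-simplex of
`Config.DiploSimplex.exists_config`). [cite: BallingerEtAl2009, §3.4] -/
theorem riesz_minimiser_isometric_nodeset (hn : 3 ≤ n) (p : ℝ) (hp : 0 < p)
    (C : Finset (EuclideanSpace ℝ (Fin n))) (h1 : ∀ x ∈ C, ‖x‖ = 1) (hN : C.card = 2 * n + 2)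
    (hanti : ∀ x ∈ C, -x ∈ C)
    (hle : ∑ x ∈ C, ∑ y ∈ C.erase x, (2 - 2 * inner ℝ x y) ^ (-p) ≤
      (2 * n + 2 : ℝ) * ((4 : ℝ) ^ (-p) + n * (2 + 2 / (n : ℝ)) ^ (-p) + n * (2 - 2 / (n : ℝ)) ^ (-p)))
    (X : Finset (EuclideanSpace ℝ (Fin n))) (hX1 : ∀ x ∈ X, ‖x‖ = 1) (hXcard : X.card = 2 * n + 2)
    (hXZ : ∀ x ∈ X, ∀ y ∈ X, x ≠ y →
      inner ℝ x y = -1 ∨ inner ℝ x y = -1 / (n : ℝ) ∨ inner ℝ x y = 1 / (n : ℝ)) :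
    ∃ Ψ : EuclideanSpace ℝ (Fin n) ≃ₗᵢ[ℝ] EuclideanSpace ℝ (Fin n), C = X.image Ψ :=
  Config.DiploSimplexUnique.isometric_of_nodesets hn X C hX1 hXcard hXZ h1 hN
    (riesz_nodeset_of_energy_le hn p hp C h1 hN hanti hle)

end Summit.Ventures.PackingBounds.Energy.DiploSimplexAntipodal

end
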